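import Summits.BirchSwinnertonDyer.BirchSwinnertonDyer.Theorems.PrintCf2RubinValueTwoEllipticUnitsGlobalMeasure
import Summits.BirchSwinnertonDyer.BirchSwinnertonDyer.Theorems.PrintCf2RubinValueTwoEllipticUnitsLocalMeasureDischarged
import HarnessLib

/-!
# de Shalit II.4.12 ON `𝒢 = Γ_K` for the elliptic units — EVERY non-print hypothesis DISCHARGED at a principal split prime `v ∣ 2`
# of an imaginary quadratic field (the `Γ_K` twin of `…EllipticUnitsLocalMeasureDischarged`)

Cell `bsd-print-cf2`, width seat `bsd-line-cf2-p1-w2` g23; `--supports` stmt-BirchSwinnertonDyer-24721 (helper, Theses-free). THEOREMS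
ONLY; CONDITIONAL on the FOUR published named facts `DeShalit1987.prop24_i_mem_rayClassField`, `prop24_ii_galoisAction`,
`prop24_iii_unit`, `prop25_i_normRelation` (hypotheses, never asserted).

-w8 g9's `EllipticUnitsGlobal.exists_groupDistribution_twisting_eq_induceFrom_ellipticUnitsGlobal_of_principal`
(`…EllipticUnitsGlobalMeasure.lean`) is de Shalit's measure `μ(𝔪)` on `Γ_K` along `Gal(K̄/K(𝔪v^{n+1}))` with `δ_{g_𝔠, N𝔠} μ = i(e(𝔠))` for
EVERY twist `𝔠` prime to `𝔪v` and ARBITRARY lifts `g_𝔠 ∈ Γ_K`, from the same thirty pieces of local / global data as the one-`𝔓` theorem.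
THIS file runs the discharge chain of `EllipticUnitsLocal.Discharged.exists_ellipticUnitsLocalMeasure_of_principal_split` (cf2c-w4 g10's
DISCHARGE RECIPE: `e₂ hq h2` at `e = f = 1`, `f u α` from L13, `E := unramifiedLevel`, `σ₀ ε θ j ψ`, division twists `α₁, α₂ = ᾱ₁` from
L14 ∘ `exists_conj_divisionData`) on THAT theorem, with the twist family := ALL ideals `𝔠 ≠ 0` prime to `𝔪v`, their lifts chosen by
`exists_forall_absRestrictNormalHom_eq_artinSymbol` and their elliptic units by `exists_forall_isThetaValueOne'`:

* ★★★ `exists_ellipticUnitsGlobalMeasure_of_principal_split` — **for `K` imaginary quadratic, `2 = v v̄` split, `v = (α₀)`, `𝔪 ≠ 0, ⊤`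
  `Aut(𝓞_K)`-stable with `w_𝔪 = 1`, `v ∤ 𝔪`, GIVEN the four prints: ∃ (all the data), ∃ μ on `Γ_K` along `absRayAdicTower h𝔪 v`,
  `‖μ‖ = 1`, `δ_{g_𝔠, N𝔠} μ = induceFrom (localMeasureFamily ∘ ofGlobalUnits) (e(𝔠))` levelwise for EVERY `𝔠 ≠ 0` prime to `𝔪v`**
  (the conclusion of -w8 g9's theorem VERBATIM under the existential telescope).

HONEST FRAMING: plumbing / integration of accepted kernel theorems; the four prints stay hypotheses; the analytic heart (Eisenstein numbers =
`L`-values, de Shalit II.4.9–4.10) is NOT here; nothing here closes a crux; no summit statement is proved; BSD is not proved by any of this.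

## References
* [deShalit1987] E. de Shalit, *Iwasawa theory of elliptic curves with complex multiplication* (1987), II.4.12 (p. 66–69), II.4.17 (p. 77–78).
* [NeukirchANT1999] J. Neukirch, *Algebraic Number Theory* (1999), Ch. I §9 (9.1), Ch. VI §7 Thm. (7.1).
-/

-- the summit namespace `Summit.BirchSwinnertonDyer.BirchSwinnertonDyer` repeats the problem name by design (D-0017)
set_option linter.dupNamespace false
set_option autoImplicit false

noncomputable section

open scoped Classical nonZeroDivisors NumberField
open Field IsDedekindDomain IsDedekindDomain.HeightOneSpectrum ValuativeRel IsLocalRing MvPowerSeries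
open Literature.NumberTheory.NumberFields
open Literature.NumberTheory.GaloisRepresentations Literature.NumberTheory.GaloisRepresentations.IsNonarchimedeanLocalField
  Literature.NumberTheory.GaloisRepresentations.LubinTate Literature.NumberTheory.GaloisRepresentations.ArtinLocalGlobal
  Literature.NumberTheory.PAdicHodge
open Literature.NumberTheory.EllipticCurves Literature.NumberTheory.EllipticCurves.GroupDistribution
open Literature.NumberTheory.ComplexMultiplication.EllipticUnits
open Literature.NumberTheory.LFunctions.AbelianDensity (artinSymbol)
open Summit.BirchSwinnertonDyer.BirchSwinnertonDyer.Theorems.PrintCf2.EllipticUnitsLocal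

namespace Summit.BirchSwinnertonDyer.BirchSwinnertonDyer.Theorems.PrintCf2.EllipticUnitsGlobal.Discharged

variable {K : Type} [Field K] [NumberField K]

section Discharged

attribute [local instance] GlobalNormCoherentUnits.instCommMonoid GlobalNormCoherentUnits.galAction
attribute [local instance] ltNormUniformSpace ltNormIsUniformAddGroup rk1 nF nE fintypeResidueField
attribute [local instance] RelNormCoherentUnits.instCommMonoid

variable [NumberField.IsTotallyComplex K] {𝔪 : Ideal (𝓞 K)} {v vbar : HeightOneSpectrum (𝓞 K)}

set_option maxHeartbeats 1600000 in
/-- ★★★ **de Shalit II.4.12 ON `Γ_K` for the elliptic units with EVERY non-print hypothesis discharged.**  Let `K` be imaginary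
quadratic, `2 = v v̄` split (`2 ∈ v`, `2 ∈ v̄`, `v̄ ≠ v`) with `v = (α₀)` principal, `𝔪 ≠ 0, ⊤` an `Aut(𝓞_K)`-stable modulus with
`w_𝔪 = 1` and `v ∤ 𝔪`, and `ι : K → ℂ`.  GIVEN de Shalit II.2.4 (i)/(ii)/(iii) and II.2.5 (i) as named facts, THERE EXIST the local data
`hq h2 u α f E hE hdegE σ₀ ε θ j e₂ ψ` (as in `EllipticUnitsLocal.Discharged.exists_ellipticUnitsLocalMeasure_of_principal_split`) and —
for EVERY ideal `𝔠 ≠ 0` prime to `𝔪v` — a lift `g_𝔠 ∈ Γ_K` of its Artin symbols on all `K(𝔪v^{m+1})` and the elliptic units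
`x^𝔠_m = Θ(1; 𝔪v^{m+1}, 𝔠)`, AND **a bounded distribution `μ` on `Γ_K` along `Gal(K̄/K(𝔪v^{n+1}))` (`absRayAdicTower h𝔪 v`) with
`‖μ‖ = 1` and `δ_{g_𝔠, N𝔠} μ = induceFrom (localMeasureFamily ∘ ofGlobalUnits) (e(𝔠))` levelwise for every such `𝔠`** — the conclusion
of `EllipticUnitsGlobal.exists_groupDistribution_twisting_eq_induceFrom_ellipticUnitsGlobal_of_principal` VERBATIM, its division twists
`α₁, α₂ = ᾱ₁` supplied by `exists_divisionTwists` ∘ `EllipticUnitsLocal.Discharged.exists_conj_divisionData`.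
[cite: deShalit1987, II.4.12 (p. 66–69), II.4.17 (p. 77–78)] [cite: NeukirchANT1999, Ch. VI §7 Thm. (7.1)] -/
theorem exists_ellipticUnitsGlobalMeasure_of_principal_split
    (h24i : DeShalit1987.prop24_i_mem_rayClassField) (h24ii : DeShalit1987.prop24_ii_galoisAction)
    (h24iii : DeShalit1987.prop24_iii_unit) (h25 : DeShalit1987.prop25_i_normRelation)
    (hK : IsImaginaryQuadratic K) (ι : K →+* ℂ)
    (h𝔪0 : 𝔪 ≠ ⊥) (h𝔪1 : 𝔪 ≠ ⊤) (hw : ∀ u : (𝓞 K)ˣ, (u : 𝓞 K) - 1 ∈ 𝔪 → u = 1)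
    (h𝔪σ : ∀ (σ : 𝓞 K ≃+* 𝓞 K) (y : 𝓞 K), y ∈ 𝔪 → σ y ∈ 𝔪)
    (hv2 : ((2 : ℕ) : 𝓞 K) ∈ v.asIdeal) (hvbar2 : ((2 : ℕ) : 𝓞 K) ∈ vbar.asIdeal) (hne : vbar ≠ v) (hv : ¬ 𝔪 ≤ v.asIdeal)
    {α₀ : 𝓞 K} (hv0 : v.asIdeal = Ideal.span {α₀}) :
    ∃ (hq : residueFieldCard (v.adicCompletion K) = 2)
      (h2 : (valuation (v.adicCompletion K)).IsUniformizer ((((2 : ℕ) : 𝒪[v.adicCompletion K]) : v.adicCompletion K)))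
      (u : 𝒪[v.adicCompletion K]ˣ)
      (α : 𝓞 K) (hα0 : α ≠ 0) (hα𝔪 : α - 1 ∈ 𝔪) (hαw : ∀ w : HeightOneSpectrum (𝓞 K), w ≠ v → α ∉ w.asIdeal)
      (f : ℕ) (hαπ : ((α : K) : v.adicCompletion K) =
        ((((u : 𝒪[v.adicCompletion K]) * ((2 : ℕ) : 𝒪[v.adicCompletion K]) : 𝒪[v.adicCompletion K]) : v.adicCompletion K)) ^ f)
      (E : IntermediateField (v.adicCompletion K) (AlgebraicClosure (v.adicCompletion K)))
      (_ : FiniteDimensional (v.adicCompletion K) E) (_ : IsGalois (v.adicCompletion K) E) (hE : E ≤ maxUnramified (v.adicCompletion K))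
      (hdegE : ∀ w : WeilGroup (v.adicCompletion K),
        WeilGroup.toAbsGalois (v.adicCompletion K) w ∈ E.fixingSubgroup → (f : ℤ) ∣ WeilGroup.deg w)
      (σ₀ : absoluteGaloisGroup (v.adicCompletion K)) (hσ₀ : IsAbsArithFrob σ₀)
      (ε : (maxUnramifiedCompletion (v.adicCompletion K))ˣ)
      (hε : maxUnramifiedCompletion.galAut (v.adicCompletion K) σ₀ (ε : maxUnramifiedCompletion (v.adicCompletion K)) =
        algebraMap 𝒪[v.adicCompletion K] (maxUnramifiedCompletion (v.adicCompletion K)) (u : 𝒪[v.adicCompletion K]) *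
          (ε : maxUnramifiedCompletion (v.adicCompletion K)))
      (θ : CompletedAlgClosure (v.adicCompletion K) →+* ℂ_[2]) (_ : Continuous θ)
      (hθ1 : ∀ z : CBall (v.adicCompletion K), ‖θ (z : CompletedAlgClosure (v.adicCompletion K))‖ ≤ 1)
      (_ : ∀ ζ' : ℂ_[2], (∃ n : ℕ, ζ' ^ 2 ^ n = 1) →
        ∃ ζ : CompletedAlgClosure (v.adicCompletion K), (∃ n : ℕ, ζ ^ 2 ^ n = 1) ∧ θ ζ = ζ')
      (j : unitBall E →+* UnrCoeff (v.adicCompletion K))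
      (_ : j.comp (algebraMap (LTCoeff (v.adicCompletion K)) (unitBall E)) =
        (intToUnrCoeff (v.adicCompletion K)).comp (LTCoeff.of (v.adicCompletion K)).symm.toRingHom)
      (hjC : (algebraMap (UnrCoeff (v.adicCompletion K)) (CBall (v.adicCompletion K))).comp j = unitBallToCBall E)
      (e₂ : v.adicCompletionIntegers K ≃+* ℤ_[2])
      (_ : ∀ a : 𝒪[v.adicCompletion K], (θ.comp ((CBall (v.adicCompletion K)).subtype.comp
          (algebraMap (UnrCoeff (v.adicCompletion K)) (CBall (v.adicCompletion K))))) (intToUnrCoeff (v.adicCompletion K) a) =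
        padicIntCast ℂ_[2] (((e₂ : v.adicCompletionIntegers K →+* ℤ_[2]).comp
          (integerEquivAdicCompletionIntegers v).toRingHom) a))
      (ψ : (n : ℕ) → ↥(absRestrictNormalHom (rayClassField K 𝔪)).ker ⧸ (rayAdicTower (𝔪 := 𝔪) h𝔪0 v).U n → ZMod (2 ^ (n + 1)))
      (hψ : ∀ (n : ℕ) (g : ↥(absRestrictNormalHom (rayClassField K 𝔪)).ker), g ∈ (rayAdicTower (𝔪 := 𝔪) h𝔪0 v).U 0 →
        ψ n ((rayAdicTower (𝔪 := 𝔪) h𝔪0 v).proj n g) =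
          PadicInt.toZModPow (n + 1) ((((Units.map (e₂ : v.adicCompletionIntegers K →+* ℤ_[2]).toMonoidHom).comp
            (rayAdicCharacter h𝔪0 hv hw))⁻¹ g : ℤ_[2]ˣ) : ℤ_[2]))
      (g : {c : Ideal (𝓞 K) // c ≠ ⊥ ∧ IsCoprime c (𝔪 * v.asIdeal)} → absoluteGaloisGroup K)
      (_ : ∀ (c : {c : Ideal (𝓞 K) // c ≠ ⊥ ∧ IsCoprime c (𝔪 * v.asIdeal)}) (m : ℕ),
        absRestrictNormalHom (rayClassField K (𝔪 * v.asIdeal ^ (m + 1))) (g c) =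
          artinSymbol (galFrob K (rayClassField K (𝔪 * v.asIdeal ^ (m + 1)))) c.1)
      (x : ∀ (_ : {c : Ideal (𝓞 K) // c ≠ ⊥ ∧ IsCoprime c (𝔪 * v.asIdeal)}) (m : ℕ), rayClassField K (𝔪 * v.asIdeal ^ (m + 1)))
      (hx : ∀ (c : {c : Ideal (𝓞 K) // c ≠ ⊥ ∧ IsCoprime c (𝔪 * v.asIdeal)}) (m : ℕ),
        IsThetaValueOne ι (𝔪 * v.asIdeal ^ (m + 1)) c.1
          (algClosureEmb ι ((x c m : rayClassField K (𝔪 * v.asIdeal ^ (m + 1))) : AlgebraicClosure K)))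
      (_ : ∀ n, ((rayAdicTower (𝔪 := 𝔪) h𝔪0 v).U n).Normal) (_ : ∀ n, ((absRayAdicTower (𝔪' := 𝔪) h𝔪0 v).U n).Normal),
    letI := rayAction h𝔪0 hv hw (isUniformizer_unit_mul h2 u) E hE
    ∃ μ : GroupDistribution (absRayAdicTower (𝔪' := 𝔪) h𝔪0 v) ℂ_[2], μ.bound = 1 ∧
      ∀ (c : {c : Ideal (𝓞 K) // c ≠ ⊥ ∧ IsCoprime c (𝔪 * v.asIdeal)}) (n : ℕ) (b : absoluteGaloisGroup K ⧸ (absRayAdicTower (𝔪' := 𝔪) h𝔪0 v).U n),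
        (twisting (g c) (Ideal.absNorm c.1 : ℂ_[2]) μ).μ n b =
        (GroupDistribution.induceFrom (Γ := absoluteGaloisGroup K) (fun n ↦ rayAdicTower_U_eq_subgroupOf (𝔪 := 𝔪) h𝔪0 v n)
          (fun b : GlobalNormCoherentUnits h𝔪0 v ↦
            localMeasureFamily h𝔪0 hv hw hq h2 u E hE hσ₀ hε θ hθ1 j hjC e₂ ψ hψ
              (RelNormCoherentUnits.ofGlobalUnits h𝔪0 hv hw (isUniformizer_unit_mul h2 u) hα0 hα𝔪 hαw hαπ E hE hdegE b))
          zero_le_one (fun _ ↦ le_rfl)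
          (ellipticUnitsGlobal h24iii h25 hK ι h𝔪0 h𝔪1 hv hw c.2.1 c.2.2 (x c) (hx c))).μ n b := by
  -- (0) the frame: `[K : ℚ] = 2`, `e(v|2) = f(v|2) = 1`
  have hK2 : Module.finrank ℚ K = 2 := hK.1
  haveI := liesOver_ratPlace_of_natCast_mem K v (p := 2) hv2
  obtain ⟨he, hf⟩ := ramificationIdx_eq_one_and_inertiaDeg_eq_one_of_natCast_mem_of_ne K hK2 (p := 2) hv2 hvbar2 hne
  -- (1) `e₂ : 𝒪_v ≃ ℤ₂`, `hq`, `h2`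
  set e₂ : v.adicCompletionIntegers K ≃+* ℤ_[2] := padicIntEquivOfDegreeOne K 2 v he hf with he₂
  have hq : residueFieldCard (v.adicCompletion K) = 2 := residueFieldCard_adicCompletion_of_padicIntEquiv (v := v) e₂
  have h2 : (valuation (v.adicCompletion K)).IsUniformizer ((((2 : ℕ) : 𝒪[v.adicCompletion K]) : v.adicCompletion K)) :=
    isUniformizer_natCast_adicCompletion_of_padicIntEquiv (v := v) e₂
  -- (2) the absolute Lubin–Tate model at the principal `v = (α₀)`: `f`, `u`, `α = α₀^f`
  obtain ⟨f, u, hf0, hα0, hα𝔪, hαw, hαπ⟩ := exists_absoluteModel_of_asIdeal_eq_span h𝔪0 hv e₂ hv0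
  -- (3) the unramified Galois base `E := K_v(ζ_{2^f − 1})`
  obtain ⟨hfd, hab, -⟩ := LocalWeilDatum.unramifiedLevel_finite_abelian_unramified (v.adicCompletion K) hf0
  haveI := hfd
  haveI := hab
  have hE : LocalWeilDatum.unramifiedLevel (v.adicCompletion K) f ≤ maxUnramified (v.adicCompletion K) :=
    unramifiedLevel_le_maxUnramified _ hf0
  have hdegE : ∀ w : WeilGroup (v.adicCompletion K), WeilGroup.toAbsGalois (v.adicCompletion K) w ∈
      (LocalWeilDatum.unramifiedLevel (v.adicCompletion K) f).fixingSubgroup → (f : ℤ) ∣ WeilGroup.deg w :=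
    fun w hw' ↦ dvd_deg_of_toAbsGalois_mem_fixingSubgroup_unramifiedLevel _ hf0 w hw'
  -- (4) the local analytic data: `σ₀`, `ε`, `θ`, `j`
  obtain ⟨σ₀, hσ₀⟩ := exists_isAbsArithFrob_holds (v.adicCompletion K)
  obtain ⟨ε, hε⟩ := exists_unit_galAut_eq_mul hσ₀ u
  obtain ⟨θ, hθc, -, hθ1, hθζ, hΘe, -, -⟩ := Seam.exists_theta_two_moments_padicEquivOfDegreeOne K v he hf
  -- (5) the cell maps of `κ_v⁻¹`
  obtain ⟨ψ, hψ⟩ := SubgroupTower.exists_cellMap_of_character (rayAdicTower (𝔪 := 𝔪) h𝔪0 v)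
    ((Units.map (e₂ : v.adicCompletionIntegers K →+* ℤ_[2]).toMonoidHom).comp (rayAdicCharacter h𝔪0 hv hw))⁻¹
    (mem_rayAdicTower_iff_inv h𝔪0 h𝔪0 hv hw e₂ le_rfl hv)
  -- (6) the twist family: ALL ideals prime to `𝔪v`, arbitrary Galois lifts of their Artin symbols, their elliptic units
  have hG : ∀ c : {c : Ideal (𝓞 K) // c ≠ ⊥ ∧ IsCoprime c (𝔪 * v.asIdeal)}, ∃ σ : absoluteGaloisGroup K,
      ∀ m : ℕ, absRestrictNormalHom (rayClassField K (𝔪 * v.asIdeal ^ (m + 1))) σ =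
        artinSymbol (galFrob K (rayClassField K (𝔪 * v.asIdeal ^ (m + 1)))) c.1 :=
    fun c ↦ exists_forall_absRestrictNormalHom_eq_artinSymbol h𝔪0 v c.2.1 c.2.2
  choose g hg using hG
  have hX : ∀ c : {c : Ideal (𝓞 K) // c ≠ ⊥ ∧ IsCoprime c (𝔪 * v.asIdeal)},
      ∃ x : ∀ m : ℕ, rayClassField K (𝔪 * v.asIdeal ^ (m + 1)),
        ∀ m, IsThetaValueOne ι (𝔪 * v.asIdeal ^ (m + 1)) c.1
          (algClosureEmb ι ((x m : rayClassField K (𝔪 * v.asIdeal ^ (m + 1))) : AlgebraicClosure K)) :=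
    fun c ↦ exists_forall_isThetaValueOne' h24i hK ι h𝔪0 v c.2.1 c.2.2
  choose x hx using hX
  -- (7) the division twists `α₁`, `α₂ = ᾱ₁`
  obtain ⟨σ, hσσ, hσv', hnorm⟩ :=
    EllipticUnitsLocal.Discharged.exists_conj_divisionData (K := K) hK2 Nat.prime_two hv2 hvbar2 hne
  obtain ⟨α₁, α₂, hα₁0, hα₂0, hα₁𝔪, hα₂𝔪, hα₁c, hα₂c, hs₁, hs₁', hs₂, hne12, hN1, h4, hN12⟩ :=
    exists_divisionTwists hv hw e₂ σ hσσ (h𝔪σ σ) hne hσv' hnorm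
  haveI hN : ∀ n, ((rayAdicTower (𝔪 := 𝔪) h𝔪0 v).U n).Normal := fun n ↦ rayAdicTower_U_normal h𝔪0 v n
  haveI hNabs : ∀ n, ((absRayAdicTower (𝔪' := 𝔪) h𝔪0 v).U n).Normal := fun n ↦ absRayAdicTower_U_normal h𝔪0 v n
  -- (8) assemble
  refine ⟨hq, h2, u, α₀ ^ f, hα0, hα𝔪, hαw, f, hαπ, LocalWeilDatum.unramifiedLevel (v.adicCompletion K) f, hfd, inferInstance, hE,
    hdegE, σ₀, hσ₀, ε, hε, θ, hθc, hθ1, hθζ, unitBallToUnrCoeff hE, unitBallToUnrCoeff_comp_algebraMap hE,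
    algebraMap_comp_unitBallToUnrCoeff hE, e₂, hΘe, ψ, hψ, g, hg, x, hx, hN, hNabs, ?_⟩
  exact exists_groupDistribution_twisting_eq_induceFrom_ellipticUnitsGlobal_of_principal h24ii h24iii h25 hK ι h𝔪0 h𝔪1 hv hw hq
    h2 u hα0 hα𝔪 hαw hαπ (LocalWeilDatum.unramifiedLevel (v.adicCompletion K) f) hE hdegE hσ₀ hε θ hθ1 (unitBallToUnrCoeff hE)
    (unitBallToUnrCoeff_comp_algebraMap hE) (algebraMap_comp_unitBallToUnrCoeff hE) e₂ hΘe ψ hψ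
    (fun c : {c : Ideal (𝓞 K) // c ≠ ⊥ ∧ IsCoprime c (𝔪 * v.asIdeal)} ↦ c.1) (fun c ↦ c.2.1) (fun c ↦ c.2.2) g hg x hx (s := 1) le_rfl
    ⟨Ideal.span {α₁}, mt Ideal.span_singleton_eq_bot.mp hα₁0, hα₁c⟩ ⟨Ideal.span {α₂}, mt Ideal.span_singleton_eq_bot.mp hα₂0, hα₂c⟩
    rfl rfl hα₁𝔪 hα₂𝔪 hs₁ hs₁' hs₂ hne12 hN1 h4 hN12

end Discharged

end Summit.BirchSwinnertonDyer.BirchSwinnertonDyer.Theorems.PrintCf2.EllipticUnitsGlobal.Discharged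

end
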